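import Summits.Ventures.PercRepro.S1CFGDepFourSharpBase

/-!
# PercRepro — THE SHARP DEPENDENT-`4`-SET CAP (p1, gen 40)

`M` finite, simple (no dependent pair), coloop-free, of nullity `ν ≥ 2` on `n` points; `D₄ := #{X ⊆ E : |X| = 4, rk X ≤ 3}`.
THE CAP (`ncard_four_eRk_le_three_le_sharp`): `D₄ ≤ B(ν, n) := C(ν + 1, 4) + (n − ν − 1)·C(ν + 1, 3) + C(ν + 1, 2)` —
S1CFGDepFour's cap without the slack `(n − 3)`; EXACT at `n = ν + 3` (rank `3`: `C(ν + 3, 4)`, Vandermonde), within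
`C(ν + 1, 2)` of the line-plus-circuit count `C(ν + 1, 4) + (n − ν − 1)·C(ν + 1, 3)` for every `n`. Numerals
`150 / 266` at `(5, 12) / (6, 13)` (S1CFGDepFour: `159 / 276`; the landed chain: `241 / 461`).

THE PROOF is S1CFGDepFour's induction with the slack removed (S1CFGDepFourSharpArith) and THE EXACT BASE `ν = 2`:
`D₄ ≤ n`. For `n ≥ 6`: `c₃ ≤ 2` (S1CFGTrianglesTwo); if `c₃ ≤ 1`, `D₄ ≤ (n − 3)·c₃ + c₄ ≤ (n − 3) + ⌊n/(n − 4)⌋ ≤ n`; if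
`c₃ = 2`, two distinct rank-`2` triples `T₁ ≠ T₂` have `|T₁ ∪ T₂| − rk (T₁ ∪ T₂) ≥ 2` (submodularity with
`rk (T₁ ∩ T₂) = |T₁ ∩ T₂| ≤ 2`), so `T₁ ∪ T₂ = E` (a proper subset has nullity `≤ 1`): `n ≤ 6`, and at `n = 6` the
triangles are disjoint and a dependent `4`-set meets one of them in `3` points (a `2 + 2` split spans `E`:
`T_i ⊆ cl (X ∩ T_i)`), so `D₄ ≤ 3 + 3 = 6` (`ncard_four_eRk_le_three_le_six_of_disjoint`).
Nothing about any cell is claimed. Axioms: standard.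
-/

open scoped Matroid

namespace PercRepro

namespace S1CFG

open Set S1CF

variable {α : Type}

/-- **THE INDUCTION STEP, SHARP** `ν = w + 1 ≥ 3` from the sharp cap at nullity `w`. -/
theorem ncard_four_eRk_le_three_le_sharp_step (M : Matroid α) [M.Finite] {w : ℕ} (hw : 2 ≤ w)
    (hd : M.E.encard = M.eRank + ((w + 1 : ℕ) : ℕ∞)) (hK : ∀ e, ¬ M.IsColoop e)
    (h0 : {P : Set α | P ⊆ M.E ∧ P.ncard = 2 ∧ M.Dep P}.ncard = 0)
    (ih : ∀ (N : Matroid α) [N.Finite], N.E.encard = N.eRank + (w : ℕ∞) → (∀ x, ¬ N.IsColoop x) →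
      {P : Set α | P ⊆ N.E ∧ P.ncard = 2 ∧ N.Dep P}.ncard = 0 →
      {X : Set α | X ⊆ N.E ∧ X.ncard = 4 ∧ N.eRk X ≤ 3}.ncard ≤
        (w + 1).choose 4 + (N.E.ncard - w - 1) * (w + 1).choose 3 + (w + 1).choose 2) :
    {X : Set α | X ⊆ M.E ∧ X.ncard = 4 ∧ M.eRk X ≤ 3}.ncard ≤
      (w + 2).choose 4 + (M.E.ncard - (w + 1) - 1) * (w + 2).choose 3 + (w + 2).choose 2 := by
  have hEfin := M.ground_finite
  have hnE := ncard_ground_eq_eRk_toNat_add M hd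
  rcases Nat.lt_or_ge M.E.ncard (w + 5) with hlt | hn
  · have := (ncard_four_eRk_le_three_le_choose M (subset_refl M.E)).trans
      (sharp_small (ν := w + 1) (n := M.E.ncard) (by omega))
    simpa using this
  have hn2 : 2 ≤ M.E.ncard := by omega
  have hc : 3 ≤ (w + 1).choose 2 := by
    have := Nat.choose_le_choose 2 (show 3 ≤ w + 1 by omega)
    simpa using this
  by_cases hser : ∃ e ∈ M.E, ∃ f ∈ M.E, e ≠ f ∧ f ∉ M.closure (M.E \ {e, f})
  · -- CASE A: a series pair
    obtain ⟨e, he, f, hf, hef, hser⟩ := hser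
    set Z := {z | z ∈ M.E ∧ (z = e ∨ z ∉ M.closure (M.E \ {e, z}))} with hZ
    have hZE : Z ⊆ M.E := seriesClass_subset_ground M e
    have hZfin : Z.Finite := hEfin.subset hZE
    have hZcirc : ∀ C, M.IsCircuit C → ∀ z ∈ Z, z ∈ C → Z ⊆ C :=
      fun C hC z hz hzC => isCircuit_seriesClass_subset M hK he hC hz hzC
    have hZ2 : 2 ≤ Z.ncard := two_le_ncard_seriesClass M he hf hef hser
    have hfZ : f ∈ Z := ⟨hf, Or.inr hser⟩
    have heZ : e ∈ Z := mem_seriesClass_self M he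
    set S := M.E \ Z with hS
    have hSE : S ⊆ M.E := sdiff_subset
    have hSfin : S.Finite := hEfin.subset hSE
    haveI : (M ↾ S).Finite := M.restrict_finite hSfin
    have hmz : S.ncard + Z.ncard = M.E.ncard := Set.ncard_sdiff_add_ncard_of_subset hZE hEfin
    have hnull : S.ncard = (M.eRk S).toNat + w := by
      have := ncard_sdiff_seriesClass_eq M hd hK he (by omega)
      rw [Nat.add_sub_cancel] at this
      exact this
    have hd' := restrict_hd M hSE hnull
    have hK' := restrict_hK M hSE (fun g hg => mem_closure_sdiff_seriesClass M hK he hg)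
    have h0' := restrict_h0 M hSE h0
    have hS2 : w + 2 ≤ S.ncard := by
      rcases Nat.lt_or_ge S.ncard 2 with hlt | hge
      · omega
      · have := two_le_eRk_toNat_of_no_dep_pair M h0 hSE hge
        omega
    have hsplit := ncard_four_eRk_le_three_le_sdiff_add_of_circuits M h0 hn2 hZE hZcirc
    rw [← hS] at hsplit
    rcases Nat.lt_or_ge S.ncard (w + 3) with hSlt | hSge
    · -- the degenerate case `|S| = w + 2`: all `4`-subsets, the crude triangle cap, `|Z| ≥ 3`
      have hSeq : S.ncard = w + 2 := by omega
      have hz3 : 3 ≤ Z.ncard := by omega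
      have hD' : {X : Set α | X ⊆ S ∧ X.ncard = 4 ∧ M.eRk X ≤ 3}.ncard ≤ (w + 2).choose 4 := by
        have := ncard_four_eRk_le_three_le_choose M hSE
        rw [hSeq] at this
        exact this
      have hc3 : {T : Set α | T ⊆ S ∧ T.ncard = 3 ∧ M.eRk T ≤ 2}.ncard ≤ (w + 2).choose 3 := by
        have := ncard_three_eRk_le_two_le_of_no_dep_pair_restrict M h0 hSE
        have hval : S.ncard - (M.eRk S).toNat + 2 = w + 2 := by omega
        rw [hval] at this
        exact this
      have hextra : {X : Set α | X ⊆ M.E ∧ X.ncard = 4 ∧ M.eRk X ≤ 3 ∧ Z ⊆ X}.ncard ≤ (w + 2).choose 2 := by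
        have hc2 : w + 2 ≤ (w + 2).choose 2 := by
          have h1 : (w + 2).choose 2 * 2 = (w + 2) * (w + 1) := by
            have := Nat.choose_succ_right_eq (w + 2) 1
            simp only [Nat.choose_one_right] at this
            have h : w + 2 - 1 = w + 1 := by omega
            rw [h] at this
            exact this
          nlinarith [h1]
        rcases Nat.lt_or_ge Z.ncard 5 with hz5 | hz5
        · rcases Nat.lt_or_ge Z.ncard 4 with hz4 | hz4
          · have hz : Z.ncard = 3 := by omega
            have := ncard_four_eRk_le_three_superset_le_sub_three M hZE hz
            omega
          · have hz : Z.ncard = 4 := by omega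
            exact (ncard_four_eRk_le_three_superset_le_one M hz).trans (by omega)
        · rw [ncard_four_eRk_le_three_superset_eq_zero M hz5]
          exact Nat.zero_le _
      exact sharp_caseA_crude hmz hSeq hsplit hD' hc3 hextra
    · -- the main case `|S| ≥ w + 3`
      have hD' := ih (M ↾ S) hd' hK' h0'
      rw [restrict_count_four, Matroid.restrict_ground_eq] at hD'
      have hc3 : {T : Set α | T ⊆ S ∧ T.ncard = 3 ∧ M.eRk T ≤ 2}.ncard ≤ (w + 1).choose 3 + 1 := by
        have := triangle_cap_of_two_le (M ↾ S) hw hd' hK' h0' (by rw [Matroid.restrict_ground_eq]; exact hSge)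
        rw [restrict_count_three] at this
        exact this
      have hextra : {X : Set α | X ⊆ M.E ∧ X.ncard = 4 ∧ M.eRk X ≤ 3 ∧ Z ⊆ X}.ncard + Z.ncard ≤
          (M.E.ncard - w - 2) * (w + 1).choose 2 + (w + 1) := by
        rcases Nat.lt_or_ge Z.ncard 5 with hz5 | hz5
        · rcases Nat.lt_or_ge Z.ncard 4 with hz4 | hz4
          · rcases Nat.lt_or_ge Z.ncard 3 with hz3 | hz3
            · have hz : Z.ncard = 2 := by omega
              have hZeq : Z = {e, f} := by
                symm
                apply Set.eq_of_subset_of_ncard_le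
                · intro x hx
                  rcases hx with rfl | rfl
                  · exact heZ
                  · exact hfZ
                · rw [hz, ncard_pair hef]
                · exact hZfin
              rw [hZeq] at hZcirc
              rw [hZeq, ncard_pair hef]
              have h1 := ncard_four_eRk_le_three_superset_pair_le M hK h0 hn2 he hf hef hser hZcirc
              have h2 := two_mul_ncard_fourCircuits_pair_le M hd hK he hf hef (by omega)
              rw [Nat.add_sub_cancel] at h2
              have h3 := sharp_extra_two_le hw hn h2
              omega
            · have hz : Z.ncard = 3 := by omega
              have h1 := ncard_four_eRk_le_three_superset_le_sub_three M hZE hz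
              have h3 := sharp_extra_three_le hw hn
              omega
          · have hz : Z.ncard = 4 := by omega
            have h1 := ncard_four_eRk_le_three_superset_le_one M hz
            have : 3 * 3 ≤ (M.E.ncard - w - 2) * (w + 1).choose 2 :=
              Nat.mul_le_mul (by omega) hc
            omega
        · rw [ncard_four_eRk_le_three_superset_eq_zero M hz5]
          have : (M.E.ncard - w - 2) * 1 ≤ (M.E.ncard - w - 2) * (w + 1).choose 2 :=
            Nat.mul_le_mul_left _ (by omega)
          omega
      exact sharp_caseA hmz hSge hsplit hD' hc3 hextra
  · -- CASE B: no series pair — average over the single deletions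
    push Not at hser
    have hB : ∀ e ∈ M.E, {X : Set α | X ⊆ M.E \ {e} ∧ X.ncard = 4 ∧ M.eRk X ≤ 3}.ncard ≤
        (w + 1).choose 4 + (M.E.ncard - 1 - w - 1) * (w + 1).choose 3 + (w + 1).choose 2 := by
      intro e he
      have hSE : M.E \ {e} ⊆ M.E := sdiff_subset
      haveI : (M ↾ (M.E \ {e})).Finite := M.restrict_finite (hEfin.subset hSE)
      have hnull : (M.E \ {e}).ncard = (M.eRk (M.E \ {e})).toNat + w := by
        have := ncard_sdiff_singleton_eq_eRk_toNat_add M hd hK he (by omega)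
        rw [Nat.add_sub_cancel] at this
        exact this
      have hd' := restrict_hd M hSE hnull
      have hK' := restrict_hK M hSE (fun x hx => by
        rw [sdiff_singleton_sdiff_singleton_eq]
        exact hser e he x hx.1 (fun h => hx.2 (h ▸ mem_singleton e)))
      have h0' := restrict_h0 M hSE h0
      have := ih (M ↾ (M.E \ {e})) hd' hK' h0'
      rw [restrict_count_four, Matroid.restrict_ground_eq, Set.ncard_sdiff_singleton_of_mem he] at this
      exact this
    have h1 := mul_ncard_four_eRk_le_three_le M hB
    have h2 := sharp_caseB hw hn
    exact Nat.le_of_mul_le_mul_left (h1.trans h2) (by omega)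

/-- **THE SHARP DEPENDENT-`4`-SET CAP**: for every `ν ≥ 2`, a simple (no dependent pair), coloop-free matroid of
nullity `ν` on `n` points has at most `C(ν + 1, 4) + (n − ν − 1)·C(ν + 1, 3) + C(ν + 1, 2)` dependent `4`-sets. -/
theorem ncard_four_eRk_le_three_le_sharp_of_two_le :
    ∀ ν : ℕ, 2 ≤ ν → ∀ (M : Matroid α) [M.Finite], M.E.encard = M.eRank + (ν : ℕ∞) →
      (∀ e, ¬ M.IsColoop e) → {P : Set α | P ⊆ M.E ∧ P.ncard = 2 ∧ M.Dep P}.ncard = 0 →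
      {X : Set α | X ⊆ M.E ∧ X.ncard = 4 ∧ M.eRk X ≤ 3}.ncard ≤
        (ν + 1).choose 4 + (M.E.ncard - ν - 1) * (ν + 1).choose 3 + (ν + 1).choose 2 := by
  intro ν hν
  induction ν, hν using Nat.le_induction with
  | base =>
    intro M _ hd hK h0
    exact ncard_four_eRk_le_three_le_sharp_two M hd hK h0
  | succ w hw ih =>
    intro M _ hd hK h0
    have := ncard_four_eRk_le_three_le_sharp_step M hw hd hK h0 ih
    simpa using this

/-- The sharp cap in the usual hypothesis form. -/
theorem ncard_four_eRk_le_three_le_sharp (M : Matroid α) [M.Finite] {ν : ℕ}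
    (hd : M.E.encard = M.eRank + (ν : ℕ∞)) (hK : ∀ e, ¬ M.IsColoop e)
    (h0 : {P : Set α | P ⊆ M.E ∧ P.ncard = 2 ∧ M.Dep P}.ncard = 0) (hν : 2 ≤ ν) :
    {X : Set α | X ⊆ M.E ∧ X.ncard = 4 ∧ M.eRk X ≤ 3}.ncard ≤
      (ν + 1).choose 4 + (M.E.ncard - ν - 1) * (ν + 1).choose 3 + (ν + 1).choose 2 :=
  ncard_four_eRk_le_three_le_sharp_of_two_le ν hν M hd hK h0

/-- `D₄ ≤ 150` at nullity `5` on `12` points. -/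
theorem depFour_le_sharp_of_nullity_five_twelve (M : Matroid α) [M.Finite]
    (hd : M.E.encard = M.eRank + 5) (hK : ∀ e, ¬ M.IsColoop e)
    (h0 : {P : Set α | P ⊆ M.E ∧ P.ncard = 2 ∧ M.Dep P}.ncard = 0) (hn : M.E.ncard = 12) :
    {X : Set α | X ⊆ M.E ∧ X.ncard = 4 ∧ M.eRk X ≤ 3}.ncard ≤ 150 := by
  have := ncard_four_eRk_le_three_le_sharp M (ν := 5) (by exact_mod_cast hd) hK h0 (by norm_num)
  rw [hn] at this
  exact this.trans (by decide)

/-- `D₄ ≤ 266` at nullity `6` on `13` points. -/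
theorem depFour_le_sharp_of_nullity_six_thirteen (M : Matroid α) [M.Finite]
    (hd : M.E.encard = M.eRank + 6) (hK : ∀ e, ¬ M.IsColoop e)
    (h0 : {P : Set α | P ⊆ M.E ∧ P.ncard = 2 ∧ M.Dep P}.ncard = 0) (hn : M.E.ncard = 13) :
    {X : Set α | X ⊆ M.E ∧ X.ncard = 4 ∧ M.eRk X ≤ 3}.ncard ≤ 266 := by
  have := ncard_four_eRk_le_three_le_sharp M (ν := 6) (by exact_mod_cast hd) hK h0 (by norm_num)
  rw [hn] at this
  exact this.trans (by decide)

end S1CFG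

end PercRepro
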